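import Summits.AtomisticToContinuum.Crystallization.Theorems.ExcessDecayLiouvilleHcpLiouvilleLinearCaccioppoli
import Summits.AtomisticToContinuum.Crystallization.Theorems.ExcessDecayLiouvilleHcpLiouvilleDifferenceEquation
import Summits.AtomisticToContinuum.Crystallization.Theorems.ExcessDecayLiouvilleHcpLiouvillePathBound
import Summits.AtomisticToContinuum.Crystallization.Theorems.ExcessDecayLiouvilleHcpLiouvilleWeights

/-!
# `ExcessDecayLiouville.HcpLiouville` (stmt-AtomisticToContinuum-9332), line `Sketch`: flat period differences

Stub `stub_flatDifferences` of the line `two-level-caccioppoli` (crux `HcpLiouville`, lead skeleton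
`Lines/Sketch.lean`): LEVEL 2 of the two-level Caccioppoli–Liouville argument (Giaquinta 1984, p. 49,
footnote 8, on a lattice; dimension `n = 3 < 4`).  Let `X = {s + u s : s ∈ S}` (`S = Sites₀ t A`,
`IsDisplacement X t A u`) be a Lennard-Jones equilibrium over an admissible hcp datum, assume tangent
coercivity on the `1/40`-box (`BoxCoercive (1/40) κ₁`) and the level-1 growth bound
`GrowthBound t A (u − τ𝟙₁)`.  For a period `h = Az`, `z ∈ Λ₀`:

1. `X − h` is again an equilibrium, in displacement form `u(· + h)` over the SAME sites, and the period
   difference `w = u(· + h) − u` solves the difference equation `Σ_q [F(b_pq) − F(a_pq)] = 0`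
   (`…HcpLiouvilleDifferenceEquation`);
2. the linear Caccioppoli inequality (`…HcpLiouvilleCoercive`, `…HcpLiouvilleLinearCaccioppoli`): for the
   cut-off `χ` at centre `c`, radius `R`, `2κ₁ · nnForm(χw) ≤ 904(10/9)⁸ · B(R)` with `B(R)` a bound for
   the commutator weights `(χ p − χ q)²(dist p q)⁻⁸‖w p‖²`;
3. `B(R) = O(1/R)` (`…HcpLiouvilleWeights`) by the path bound `Σ_{B_R}‖w‖² ≤ C_z R`
   (`…HcpLiouvillePathBound`, from the growth bound; `τ𝟙₁` is `h`-periodic on `S`);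
4. read-out: `‖w p − w q‖² ≤ nnForm(χw) → 0` (`R → ∞`) for every nearest-neighbour pair, i.e.
   `NNFlat t A u`.

All `[folklore]`; a `--supports` helper for item stmt-AtomisticToContinuum-9332, nothing here closes an
item.
-/

noncomputable section

namespace Summit.AtomisticToContinuum.Crystallization.Theorems.ExcessDecayLiouville

open scoped BigOperators Topology Classical InnerProductSpace
open Literature.MathematicalPhysics.StatisticalMechanics
open Summit.AtomisticToContinuum.Crystallization.Theses.ExcessDecayLiouville
open Summit.AtomisticToContinuum.Crystallization.Theorems.PhononStabilityNegative

local notation "E3" => EuclideanSpace ℝ (Fin 3)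

/-! ## The shift field is `AΛ₀`-periodic on the sites -/

/-- The two sublattices are disjoint: `t 0 + Aζ ≠ t 1 + Aζ'`. [folklore] -/
private theorem sites_cross_ne {t : Fin 2 → E3} {A : E3 →L[ℝ] E3} (hA : Adm₀ A) (hI : Inner₀ t A)
    {ζ ζ' : E3} (hζ : ζ ∈ Λ₀) (hζ' : ζ' ∈ Λ₀) : t 0 + A ζ ≠ t 1 + A ζ' := by
  intro h
  have h1 := dist_sites_cross_ge hA hI hζ hζ'
  rw [← h, dist_self] at h1
  norm_num at h1

/-! ## The shift field is `AΛ₀`-periodic on the sites -/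

/-- **`τ𝟙₁` is periodic**: `shiftField t A τ (s + Az) = shiftField t A τ s` for a site `s` and `z ∈ Λ₀`
(the two sublattices `t m + AΛ₀` are `AΛ₀`-invariant and disjoint). [folklore] -/
theorem flatDiff_shiftField_add_apply {t : Fin 2 → E3} {A : E3 →L[ℝ] E3} (hA : Adm₀ A) (hI : Inner₀ t A)
    (τ : E3) {z : E3} (hz : z ∈ Λ₀) {s : E3} (hs : s ∈ Sites₀ t A) :
    shiftField t A τ (s + A z) = shiftField t A τ s := by
  obtain ⟨m, ζ, hζ, rfl⟩ := hs
  unfold shiftField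
  fin_cases m
  · have h1 : ¬ ∃ z' ∈ Λ₀, t 0 + A ζ + A z = t 1 + A z' := by
      rintro ⟨z', hz', h⟩
      rw [add_assoc, ← map_add] at h
      exact sites_cross_ne hA hI (hcpLiouvilleLam_add_mem hζ hz) hz' h
    have h2 : ¬ ∃ z' ∈ Λ₀, t 0 + A ζ = t 1 + A z' := by
      rintro ⟨z', hz', h⟩
      exact sites_cross_ne hA hI hζ hz' h
    simp only [Fin.zero_eta, Fin.isValue]
    rw [if_neg h1, if_neg h2]
  · have h1 : ∃ z' ∈ Λ₀, t 1 + A ζ + A z = t 1 + A z' :=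
      ⟨ζ + z, hcpLiouvilleLam_add_mem hζ hz, by rw [map_add, add_assoc]⟩
    have h2 : ∃ z' ∈ Λ₀, t 1 + A ζ = t 1 + A z' := ⟨ζ, hζ, rfl⟩
    simp only [Fin.mk_one, Fin.isValue]
    rw [if_pos h1, if_pos h2]

/-- **Path bound for the period differences of the displacement.**  Under the hypotheses of
`stub_flatDifferences` (growth bound for `v = u − τ𝟙₁`), for every `z ∈ Λ₀` the period difference
`w = u(· + Az) − u` — which agrees with `v(· + Az) − v` on the sites — satisfies
`Σ_{p ∈ U} ‖w p‖² ≤ C_z·R` on finite sets `U` of sites in balls `B_R(c)`, `R ≥ 1`. [folklore] -/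
private theorem pathBound_of_growthBound_sub_shiftField {t : Fin 2 → E3} {A : E3 →L[ℝ] E3} (hA : Adm₀ A)
    (hI : Inner₀ t A) {u : E3 → E3} {τ : E3}
    (hG : GrowthBound t A (fun s => u s - shiftField t A τ s)) {z : E3} (hz : z ∈ Λ₀) :
    ∃ C : ℝ, ∀ (c : E3) (R : ℝ), 1 ≤ R → ∀ U : Finset (Sites₀ t A),
      (∀ p ∈ U, dist (p : E3) c ≤ R) → ∑ p ∈ U, ‖u (p + A z) - u p‖ ^ 2 ≤ C * R := by
  obtain ⟨C, hC⟩ := flatDiff_pathBound_of_growthBound hA hI hG hz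
  refine ⟨C, fun c R hR U hU => ?_⟩
  refine le_trans (le_of_eq (Finset.sum_congr rfl fun p _ => ?_)) (hC c R hR U hU)
  rw [flatDiff_shiftField_add_apply hA hI τ hz p.2]
  congr 2
  abel

/-! ## The stub -/

/-- **Decay of the period-difference gradient on one bond**: under the hypotheses of the stub, for
`z ∈ Λ₀`, a nearest-neighbour pair of sites `p₀, q₀` and every radius `R ≥ 2`,
`2κ₁ ‖w p₀ − w q₀‖² ≤ 904(10/9)⁸ (3K₆C_z + 600)/R`, `w = u(· + Az) − u`. [folklore] -/
private theorem periodDiff_bond_le {κ₁ : ℝ} (hκ₁ : 0 < κ₁) (hBox : BoxCoercive (1 / 40) κ₁) {X : Set E3}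
    {t : Fin 2 → E3} {A : E3 →L[ℝ] E3} {u : E3 → E3} (hA : Adm₀ A) (hI : Inner₀ t A)
    (hEq : Equil₀ X) (hD : IsDisplacement X t A u) {z : E3} (hz : z ∈ Λ₀) {Cw : ℝ}
    (hW : ∀ (c' : E3) (R' : ℝ), 1 ≤ R' → ∀ U : Finset (Sites₀ t A),
      (∀ p ∈ U, dist (p : E3) c' ≤ R') → ∑ p ∈ U, ‖u (p + A z) - u p‖ ^ 2 ≤ Cw * R')
    {p₀ q₀ : E3} (hp₀ : p₀ ∈ Sites₀ t A) (hq₀ : q₀ ∈ Sites₀ t A) (hd : dist p₀ q₀ ≤ 11 / 10)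
    {R : ℝ} (hR : 2 ≤ R) :
    2 * κ₁ * ‖(u (p₀ + A z) - u p₀) - (u (q₀ + A z) - u q₀)‖ ^ 2 ≤
      904 * (10 / 9) ^ 8 * ((3 * (1024 / ((23 / 25) ^ 3 * (23 / 25) ^ 3)) * Cw + 600) / R) := by
  have hR1 : 1 ≤ R := by linarith
  have hR0 : 0 < R := by linarith
  have hu : ∀ s ∈ Sites₀ t A, ‖u s‖ ≤ 1 / 40 := hD.1
  have hu₁ : ∀ s ∈ Sites₀ t A, ‖u (s + A z)‖ ≤ 1 / 40 := flatDiff_norm_displaced_le hD hz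
  have hw : ∀ s ∈ Sites₀ t A, ‖u (s + A z) - u s‖ ≤ 1 / 20 := by
    intro s hs
    have := norm_sub_le (u (s + A z)) (u s)
    linarith [hu s hs, hu₁ s hs]
  have hEqn := fun p : Sites₀ t A => flatDiff_hasSum_force_difference hEq hD hz p
  have hM := flatDiff_weights_partial_sum_le (c := p₀) hA hI hR1 hw hW
  have hcacc := flatDiff_caccioppoli_estimate (u₁ := fun x => u (x + A z)) (c := p₀) hA hI hBox hu hu₁ hR0 hEqn hM
  obtain ⟨hfin, -⟩ := flatDiff_support_testField (u := u) (u₁ := fun x => u (x + A z)) (c := p₀) hA hI hR0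
  have hpair := flatDiff_nnForm_ge_pair hA hI _ hfin hp₀ hq₀ hd
  have hχp : max 0 (min 1 (2 - dist p₀ p₀ / R)) = 1 := flatDiff_cutoff_eq_one hR0 (by rw [dist_self]; linarith)
  have hχq : max 0 (min 1 (2 - dist q₀ p₀ / R)) = 1 :=
    flatDiff_cutoff_eq_one hR0 (by rw [dist_comm]; linarith)
  simp only [if_pos hp₀, if_pos hq₀, hχp, hχq, one_smul] at hpair
  have hκ : 2 * κ₁ * ‖(u (p₀ + A z) - u p₀) - (u (q₀ + A z) - u q₀)‖ ^ 2 ≤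
      2 * κ₁ * nnForm t A (fun x : E3 => if x ∈ Sites₀ t A then
        max 0 (min 1 (2 - dist x p₀ / R)) • (u (x + A z) - u x) else 0) :=
    mul_le_mul_of_nonneg_left hpair (by linarith)
  exact hκ.trans hcacc

/-- **Stub `stub_flatDifferences` (line `Sketch`, crux `HcpLiouville`)**: LEVEL 2 of the two-level
Caccioppoli–Liouville argument — under box coercivity, every period difference `u(· + Az) − u` of the
displacement form of a Lennard-Jones equilibrium with the level-1 growth bound is constant across
nearest-neighbour bonds (`NNFlat t A u`). [folklore] -/
theorem stub_flatDifferences : ∀ κ₁ : ℝ, 0 < κ₁ → BoxCoercive (1 / 40) κ₁ → ∀ (X : Set E3) (t : Fin 2 → E3) (A : E3 →L[ℝ] E3) (u : E3 → E3) (τ : E3), Adm₀ A → Inner₀ t A → Equil₀ X → IsDisplacement X t A u → GrowthBound t A (fun s => u s - shiftField t A τ s) → NNFlat t A u := by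
  intro κ₁ hκ₁ hBox X t A u τ hA hI hEq hD hG z hz p₀ hp₀ q₀ hq₀ hd
  obtain ⟨Cw, hCw⟩ := pathBound_of_growthBound_sub_shiftField hA hI hG hz
  set x : ℝ := ‖(u (p₀ + A z) - u p₀) - (u (q₀ + A z) - u q₀)‖ ^ 2 with hx
  set K : ℝ := 904 * (10 / 9) ^ 8 * (3 * (1024 / ((23 / 25) ^ 3 * (23 / 25) ^ 3)) * Cw + 600) with hK
  have key : ∀ R : ℝ, 2 ≤ R → 2 * κ₁ * x ≤ K / R := by
    intro R hR
    have h := periodDiff_bond_le hκ₁ hBox hA hI hEq hD hz hCw hp₀ hq₀ hd hR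
    rw [hx, hK, mul_div_assoc]
    exact h
  have hx0 : x = 0 := by
    by_contra hne
    have hxpos : 0 < x := lt_of_le_of_ne (by positivity) (Ne.symm hne)
    have hκx : 0 < κ₁ * x := mul_pos hκ₁ hxpos
    set R : ℝ := max 2 (K / (κ₁ * x)) with hRdef
    have hR2 : 2 ≤ R := le_max_left _ _
    have hR0 : 0 < R := by linarith
    have h1 := key R hR2
    have h2 : K / R ≤ κ₁ * x := by
      rcases le_or_gt K 0 with hK0 | hK0
      · exact (div_nonpos_of_nonpos_of_nonneg hK0 hR0.le).trans hκx.le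
      · calc K / R ≤ K / (K / (κ₁ * x)) := div_le_div_of_nonneg_left hK0.le (by positivity) (le_max_right _ _)
          _ = κ₁ * x := by field_simp
    nlinarith
  have h0 : (u (p₀ + A z) - u p₀) - (u (q₀ + A z) - u q₀) = 0 := by
    rwa [hx, sq_eq_zero_iff, norm_eq_zero] at hx0
  exact sub_eq_zero.1 h0

end Summit.AtomisticToContinuum.Crystallization.Theorems.ExcessDecayLiouville

end
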